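import Summits.QuantumFields.YangMills.Theses.FlatTubeReduction
import Summits.QuantumFields.YangMills.Theses.FemtoCutoffLadder
import Summits.QuantumFields.YangMills.Theorems.FemtoTransferGapLevels
import Summits.QuantumFields.YangMills.Theorems.FemtoTransferGapReduction
import Summits.QuantumFields.YangMills.Theorems.FemtoTransferGapPositivity
import Summits.QuantumFields.YangMills.Theorems.LuscherReductionOneSiteLevelsClosed

/-!
# Routes `FlatTubeReduction` / `FemtoCutoffLadder`, shared crux `UpStepEv` (stmt-QuantumFields-26796): CALIBRATION against the femto
# level law of record (node N34 `FemtoLevelsOfRecord`) and against crux RED of route `LuscherReduction`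
(seat ym-line-fcl-p3 g12, 2026-08-28; rung R2b1 = RECORD-label femto gap — nothing here concerns infinite volume, the continuum limit or the
Clay Yang–Mills mass gap; no summit statement is proved)

WHAT IS PROVED (sorry-free, no definitions, no named-fact hypotheses other than the explicit antecedents of the implications):
* `pair_of_twoSided` — arithmetic core: a LOWER femto law `e^{−(εΛ + CΛ²)/L}·λ₀(L) ≤ λ₁(L)` on one window lattice and an UPPER femto law
  `λ₁(L') ≤ e^{−(εΛ − CΛ²)/L'}·λ₀(L')` on another, at the SAME running parameter `Λ`, give the cross-multiplied comparison
  `λ₁(L')^{L'}·λ₀(L)^{L} ≤ e^{2CΛ²}·λ₁(L)^{L}·λ₀(L')^{L'}` — for EVERY pair `(L, L')`, any ratio, either order.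
* ★ `allPairs_of_levels : FemtoLevelsOfRecord → (all matched window pairs compare within e^{CΛ²}, eventually in L at each level lam)`.
* ★★ `upStepEv_of_levels : FemtoLevelsOfRecord → UpStepEv` (FTR decl) and `fcl_upStepEv_of_levels` (the `FemtoCutoffLadder` copy):
  the incommensurable variational crux of both routes is IMPLIED by the two-sided femto level law of record at `k = 1`
  (`Theorems.FemtoTransferGap.FemtoLevelsOfRecord`, node N34, OPEN).
* ★★ `upStepEv_of_red : Theses.LuscherReduction.RunningReduction → UpStepEv` (+ `fcl_upStepEv_of_red`): through the tree's proved seam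
  `femtoLevels_of_reduction` and the CLOSED crux ONE (`oneSiteLevels_proof`), crux RED (stmt-QuantumFields-19978) of route `LuscherReduction`
  closes item 26796 of `FlatTubeReduction` / `FemtoCutoffLadder` by name — a cross-route edge for the planners.

WHAT THIS CALIBRATES (planner-facing; the point of the file).  Precision classes of the step cruxes of the two ladder routes:
(i) BOUNDED budget `e^{CΛ²}`, threshold `L0` AFTER the level `lam` — `UpStepEv` (26796): a consequence of N34 / RED (this file); an honest
    sub-crux, never stronger than the femto physics of record.
(ii) BOUNDED budget but `L0` BEFORE `lam` — `SubOctaveBounded` 24085, `DyadicNestedUpper` 25766, `EventualTowerDominance(Pw)` 25767/25890: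
    NOT consequences of N34 as typed (N34 has `L0(lam)`); `pair_of_twoSided` gives their `L0(lam)` shadows only.
(iii) PER-STEP budget `e^{CΛ²/L'}` — `UnitUpStep` 27556 (LINE g6-A «unit-slab ladder») and its engine `PinnedUnitStepEx` 27561 — and DECAYING
    budget `e^{CΛ²/L'^σ + …}` — `OctaveStepDecay` 24153, `SmallFieldOctaveStep` 25695: NOT consequences of N34 / RED.  N34 pins
    `z_L = −L·log(λ₁/λ₀)` inside the band `[ε₁Λ − CΛ², ε₁Λ + CΛ²]`, which bounds the OSCILLATION of `L ↦ z_L` at fixed `Λ` by `2CΛ²` but says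
    nothing about its increments at the scale `Λ²/L'`: `UnitUpStep` is a SMOOTHNESS-IN-THE-CUTOFF statement (Lipschitz in `log L'` with constant
    `CΛ²`), strictly finer than R2b1/N34-precision physics; a supplier delivering Lüscher's two-term law with an `L`-uniform `O(Λ³)` remainder
    proves (i) at once and does not prove (iii).  Consequence for LINE g6-A: its restriction to unit pairs buys free kinematics (fcl-p3 g11:
    raw pull-back, `PinnedSpan.l2_rawTrial_sq_lt`) at the price of a budget no energy-level supplier meets; the pairs form (i) with the
    momentum-covariant engine `PinnedSpan.PinnedSpanUpStep` (p646974/p647766), or no engine at all (RED), is the cheaper registered target.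
HONEST FRAMING: implications only; N34, RED, 26796 remain OPEN (XL: L-uniform control of the femto-universe transfer spectrum at window
couplings is not in print).  References: M. Lüscher, NPB 219 (1983) 233 [cite: Luscher1983, §3]; M. Lüscher, G. Münster, NPB 232 (1984) 445
[cite: LuscherMunster1984, §2]; M. Reed, B. Simon IV [cite: ReedSimonIV1978, Thm. XIII.1].
-/

set_option autoImplicit false

namespace Summit.QuantumFields.YangMills.Theorems.FlatTubeReduction.LevelsCalibration

open Summit.QuantumFields.YangMills.Theorems.FemtoTransferGap
open Literature.Analysis.OperatorTheory.YMMatrixModel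

/-- Arithmetic core of the calibration.  A lower femto law at `(L, β)` (`e^{−(eΛ + CΛ²)/L}·a₀ ≤ a₁`, `a₀ = λ₀(L) ≥ 0`, `a₁ = λ₁(L)`) and an
upper femto law at `(L', β')` (`b₁ ≤ e^{−(eΛ − CΛ²)/L'}·b₀`, `b₁ = λ₁(L') ≥ 0`, `b₀ = λ₀(L') ≥ 0`) at the same running parameter `Λ` give
`b₁^{L'}·a₀^{L} ≤ e^{2CΛ²}·(a₁^{L}·b₀^{L'})`: raise to the powers `L`, `L'` (the leading terms `e^{∓eΛ}` cancel exactly). [cite: LuscherMunster1984, §2] -/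
theorem pair_of_twoSided {e C Λ a0 a1 b0 b1 : ℝ} {L L' : ℕ} (hL : 0 < L) (hL' : 0 < L')
    (ha0 : 0 ≤ a0) (hb1 : 0 ≤ b1) (hb0 : 0 ≤ b0)
    (hlow : Real.exp (-(e * Λ + C * Λ ^ 2) / (L : ℝ)) * a0 ≤ a1)
    (hup : b1 ≤ Real.exp (-(e * Λ - C * Λ ^ 2) / (L' : ℝ)) * b0) :
    b1 ^ L' * a0 ^ L ≤ Real.exp (2 * C * Λ ^ 2) * (a1 ^ L * b0 ^ L') := by
  have hLr : (0 : ℝ) < L := Nat.cast_pos.mpr hL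
  have hL'r : (0 : ℝ) < L' := Nat.cast_pos.mpr hL'
  -- the upper law raised to the power `L'`
  have h1 : b1 ^ L' ≤ Real.exp (-(e * Λ - C * Λ ^ 2)) * b0 ^ L' := by
    have h := pow_le_pow_left₀ hb1 hup L'
    rw [mul_pow, ← Real.exp_nat_mul] at h
    have hx : (L' : ℝ) * (-(e * Λ - C * Λ ^ 2) / (L' : ℝ)) = -(e * Λ - C * Λ ^ 2) := by
      field_simp
    rwa [hx] at h
  -- the lower law raised to the power `L`
  have h2 : Real.exp (-(e * Λ + C * Λ ^ 2)) * a0 ^ L ≤ a1 ^ L := by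
    have hnn : 0 ≤ Real.exp (-(e * Λ + C * Λ ^ 2) / (L : ℝ)) * a0 := mul_nonneg (Real.exp_pos _).le ha0
    have h := pow_le_pow_left₀ hnn hlow L
    rw [mul_pow, ← Real.exp_nat_mul] at h
    have hx : (L : ℝ) * (-(e * Λ + C * Λ ^ 2) / (L : ℝ)) = -(e * Λ + C * Λ ^ 2) := by
      field_simp
    rwa [hx] at h
  -- invert the lower law: `a0^L ≤ e^{eΛ + CΛ²}·a1^L`
  have h3 : a0 ^ L ≤ Real.exp (e * Λ + C * Λ ^ 2) * a1 ^ L := by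
    have h := mul_le_mul_of_nonneg_left h2 (Real.exp_pos (e * Λ + C * Λ ^ 2)).le
    rw [← mul_assoc, ← Real.exp_add] at h
    have hx : e * Λ + C * Λ ^ 2 + -(e * Λ + C * Λ ^ 2) = 0 := by ring
    rw [hx, Real.exp_zero, one_mul] at h
    exact h
  have hb0L : 0 ≤ b0 ^ L' := pow_nonneg hb0 L'
  have ha1L : 0 ≤ Real.exp (e * Λ + C * Λ ^ 2) * a1 ^ L := le_trans (pow_nonneg ha0 L) h3
  calc b1 ^ L' * a0 ^ L
      ≤ (Real.exp (-(e * Λ - C * Λ ^ 2)) * b0 ^ L') * (Real.exp (e * Λ + C * Λ ^ 2) * a1 ^ L) :=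
        mul_le_mul h1 h3 (pow_nonneg ha0 L) (mul_nonneg (Real.exp_pos _).le hb0L)
    _ = (Real.exp (-(e * Λ - C * Λ ^ 2)) * Real.exp (e * Λ + C * Λ ^ 2)) * (a1 ^ L * b0 ^ L') := by ring
    _ = Real.exp (2 * C * Λ ^ 2) * (a1 ^ L * b0 ^ L') := by
        rw [← Real.exp_add]; congr 1; congr 1; ring

/-- ★ **All matched window pairs compare within `e^{CΛ²}` under N34** (eventually in `L` at each level `lam`; ANY ratio, EITHER order):
from `FemtoLevelsOfRecord` at `k = 1`, for `L, L' ≥ L0(lam)` in the window at a common running parameter,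
`λ₁(L')^{L'}·λ₀(L)^{L} ≤ e^{CΛ²}·λ₁(L)^{L}·λ₀(L')^{L'}`.  This is the `L0(lam)` shadow of `SubOctaveBounded` ∧ `UpStepEv` ∧
`DyadicNestedUpper` (those items except `UpStepEv` put `L0` before `lam` and are NOT implied as typed). [cite: LuscherMunster1984, §2] -/
theorem allPairs_of_levels (h : FemtoLevelsOfRecord) :
    ∃ C lam0 : ℝ, 0 < lam0 ∧ ∀ lam : ℝ, 0 < lam → lam ≤ lam0 → ∃ L0 : ℕ,
      ∀ (L' : ℕ) [NeZero L'] (L : ℕ) [NeZero L], L0 ≤ L' → L0 ≤ L → ∀ β β' : ℝ,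
        InFemtoWindow lam β L → InFemtoWindow lam β' L' → luscherLambda β L = luscherLambda β' L' →
          secondValue su2Rep L' β' ^ L' * topValue su2Rep L β ^ L ≤
            Real.exp (C * luscherLambda β L ^ 2) * (secondValue su2Rep L β ^ L * topValue su2Rep L' β' ^ L') := by
  obtain ⟨C, lam0, hlam0, H⟩ := h 1
  refine ⟨2 * C, lam0, hlam0, fun lam hlam hle => ?_⟩
  obtain ⟨L0, HL⟩ := H lam hlam hle
  refine ⟨L0, ?_⟩
  intro L' _ L _ hL0' hL0 β β' hW hW' hΛ
  have hWL := HL L hL0 β hW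
  have hWL' := HL L' hL0' β' hW'
  rw [levelValue_one, levelValue_zero, levelGap_one] at hWL hWL'
  obtain ⟨_, hlowL⟩ := hWL
  obtain ⟨hupL', _⟩ := hWL'
  rw [← hΛ] at hupL'
  have hβ' : (0 : ℝ) ≤ β' := le_trans zero_le_one hW'.1
  exact pair_of_twoSided (NeZero.pos L) (NeZero.pos L') (topValue_nonneg su2Rep L β)
    (secondValue_su2Rep_nonneg L' hβ') (topValue_nonneg su2Rep L' β') hlowL hupL'

/-- ★★ **N34 ⇒ `UpStepEv`** (item stmt-QuantumFields-26796, route decl of `FlatTubeReduction`): the incommensurable variational up-step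
(`L0 ≤ L' < L < 2L'`, budget `e^{CΛ²}`, `L0` after `lam`) is the sub-octave instance of `allPairs_of_levels`. [cite: Luscher1983, §3] -/
theorem upStepEv_of_levels (h : FemtoLevelsOfRecord) :
    Summit.QuantumFields.YangMills.Theses.FlatTubeReduction.UpStepEv := by
  obtain ⟨C, lam0, hlam0, H⟩ := allPairs_of_levels h
  refine ⟨C, lam0, hlam0, fun lam hlam hle => ?_⟩
  obtain ⟨L0, HL⟩ := H lam hlam hle
  refine ⟨L0, ?_⟩
  intro L' _ L _ hL0 hlt _ β β' hW hW' hΛ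
  exact HL L' L hL0 (le_of_lt (lt_of_le_of_lt hL0 hlt)) β β' hW hW' hΛ

/-- The `FemtoCutoffLadder` copy of the shared crux (same body). [cite: Luscher1983, §3] -/
theorem fcl_upStepEv_of_levels (h : FemtoLevelsOfRecord) :
    Summit.QuantumFields.YangMills.Theses.FemtoCutoffLadder.UpStepEv :=
  upStepEv_of_levels h

/-- ★★ **RED ⇒ `UpStepEv`** — cross-route edge: crux RED of route `LuscherReduction` (`Theses.LuscherReduction.RunningReduction`,
stmt-QuantumFields-19978; the route decl is the inline restatement of `FemtoTransferGap.RunningReduction`) closes item 26796 of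
`FlatTubeReduction` by name, through the proved seam `femtoLevels_of_reduction` and the closed crux ONE (`oneSiteLevels_proof`, whose route decl is the inline
restatement of the tree decl `FemtoTransferGap.OneSiteLevels`, so it is accepted by definitional unfolding). [cite: Luscher1983, §3] -/
theorem upStepEv_of_red (hB : Summit.QuantumFields.YangMills.Theses.LuscherReduction.RunningReduction) :
    Summit.QuantumFields.YangMills.Theses.FlatTubeReduction.UpStepEv :=
  upStepEv_of_levels (femtoLevels_of_reduction oneSiteLevels_proof hB)

/-- The `FemtoCutoffLadder` copy of the RED edge. [cite: Luscher1983, §3] -/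
theorem fcl_upStepEv_of_red (hB : Summit.QuantumFields.YangMills.Theses.LuscherReduction.RunningReduction) :
    Summit.QuantumFields.YangMills.Theses.FemtoCutoffLadder.UpStepEv :=
  upStepEv_of_red hB

end Summit.QuantumFields.YangMills.Theorems.FlatTubeReduction.LevelsCalibration
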